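import Summits.AtomisticToContinuum.FouriersLaw.Theses.PhononMeanFreePath
import Summits.AtomisticToContinuum.FouriersLaw.Theorems.BoundaryKubo.Negative.LoadBearing
import Summits.AtomisticToContinuum.FouriersLaw.Theorems.BondHeatUncertaintySubdiffusiveBondHeatKernelGibbsC

/-!
# Gibbs-tested TTCF identity, helper 1: the reversed generator of the Gibbs density at unequal bath temperatures
(helpers for stub `stub_gibbsTTCF` of line `gibbs-ttcf`, crux stmt-AtomisticToContinuum-11812
`PhononMeanFreePath.BoundaryKubo`)

For an oscillator chain with confining `C²` potentials, `N ≥ 1` sites, `T > 0` and `|δ| ≤ 2T`, write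
`a = T + δ/2`, `b = T - δ/2`, `ρ = e^{-H/T}`, `W = p_0² - p_{N-1}²` and `L̂ = sdeGenerator (-Y) v_L(a) v_R(b)`
for the generator of the time-reversed (anti-friction) Langevin equation with bath temperatures `(a, b)`.

* `revGenerator_truncGibbs_sub_le_of_temp` — `L̂ (ρ χ(H/R)) = χ(H/R) · (-2γ + δ (γ/2T²) W) ρ + O(1/R)` uniformly
  (`χ = smoothCutoff`; the generator is affine in the temperatures and `L̂_{T,T} ρ = -2γρ`);
* `gibbsDensity_langevinRevKernel_response` (closed form `gibbsTTCF_revResponse`) — for the reversed kernels `P̂_s`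
  at `(a, b)`, `u ≥ 0`, `y`: `e^{2γu} P̂_u ρ(y) - ρ(y) = δ (γ/2T²) ∫₀ᵘ e^{2γs} P̂_s(Wρ)(y) ds` (Dynkin for the
  truncations, dominated convergence `R → ∞`, integrating factor; at `δ = 0` the eigen-relation of `…KernelGibbsC`).
-/

noncomputable section

open scoped NNReal ENNReal Topology
open MeasureTheory Filter Set

namespace Summit.AtomisticToContinuum.FouriersLaw.Theorems.BoundaryKubo.GibbsTtcf

open Literature.MathematicalPhysics.KineticTheory.HeatConduction
open Literature.MathematicalPhysics.KineticTheory Literature.Probability.Process OscillatorChain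
open ProbabilityTheory
open Summit.AtomisticToContinuum.FouriersLaw.Theorems.SubdiffusiveBondHeat

variable {P : OscillatorChain} {N : ℕ}

/-- **The reversed generator of the truncated Gibbs density at bath temperatures `(T + δ/2, T - δ/2)`.**
For confining `C²` potentials with `U, V ≥ 0`, `N ≥ 1`, `γ ≥ 0`, `T > 0`, `|δ| ≤ 2T` and `R ≥ 1`:
`|L̂ (e^{-H/T} χ(H/R)) - χ(H/R) (-2γ + δ (γ/(2T²)) (p_0² - p_{N-1}²)) e^{-H/T}| ≤ C/R` uniformly on phase space
(chain rule `revGenerator_comp_hamiltonian`; the `χ`-terms give the main part because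
`-(a+b+S)/T + (a p_0² + b p_{N-1}²)/T² = -2 + δ (p_0² - p_{N-1}²)/(2T²)` for `a + b = 2T`, `S = p_0² + p_{N-1}²`;
the `χ', χ''` terms carry `1/R` and the bounded weights `e^{-H/T}(1 + S)`). [folklore] -/
theorem revGenerator_truncGibbs_sub_le_of_temp (hU : ContDiff ℝ 2 P.U) (hV : ContDiff ℝ 2 P.V)
    (hU0 : ∀ q, 0 ≤ P.U q) (hV0 : ∀ r, 0 ≤ P.V r) (hN : 0 < N) (hγ : 0 ≤ P.γ) {T δ : ℝ} (hT : 0 < T)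
    (hδ : |δ| ≤ 2 * T) :
    ∃ C : ℝ, ∀ R : ℝ, 1 ≤ R → ∀ x : PhaseSpace N,
      |sdeGenerator (fun y => -P.drift N y) (P.bathVecL N (T + δ / 2)) (P.bathVecR N (T - δ / 2))
          (fun y => Real.exp (-P.hamiltonian N y / T) * smoothCutoff (P.hamiltonian N y / R)) x -
        smoothCutoff (P.hamiltonian N x / R) *
          ((-(2 * P.γ) + δ * (P.γ / (2 * T ^ 2)) *
              (x.2 ⟨0, hN⟩ ^ 2 - x.2 ⟨N - 1, Nat.sub_lt hN one_pos⟩ ^ 2)) *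
            Real.exp (-P.hamiltonian N x / T))| ≤ C / R := by
  obtain ⟨M₁, hM₁0, hM₁⟩ := exists_bound_deriv_smoothCutoff
  obtain ⟨M₂, hM₂0, hM₂⟩ := exists_bound_deriv_deriv_smoothCutoff
  refine ⟨P.γ * (M₁ * (6 * T) + M₁ * (16 * T) + M₂ * (8 * T ^ 2)), fun R hR x => ?_⟩
  have hR0 : 0 < R := lt_of_lt_of_le one_pos hR
  have hδ' := abs_le.1 hδ
  have ha0 : 0 ≤ T + δ / 2 := by linarith [hδ'.1]
  have hb0 : 0 ≤ T - δ / 2 := by linarith [hδ'.2]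
  have ha2 : T + δ / 2 ≤ 2 * T := by linarith [hδ'.2]
  have hb2 : T - δ / 2 ≤ 2 * T := by linarith [hδ'.1]
  rw [revGenerator_comp_hamiltonian hU hV hN (mul_nonneg hγ ha0) (mul_nonneg hγ hb0)
    (hasDerivAt_truncProfile T R) (hasDerivAt_deriv_truncProfile hT.ne' hR0.ne') x]
  -- notation
  set Hx := P.hamiltonian N x with hHx
  set E := Real.exp (-Hx / T) with hE
  set χ₀ := smoothCutoff (Hx / R); set χ₁ := deriv smoothCutoff (Hx / R)
  set χ₂ := deriv (deriv smoothCutoff) (Hx / R)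
  set A := x.2 ⟨0, hN⟩ ^ 2 with hA
  set B := x.2 ⟨N - 1, Nat.sub_lt hN one_pos⟩ ^ 2 with hB
  have hA0 : 0 ≤ A := sq_nonneg _; have hB0 : 0 ≤ B := sq_nonneg _
  have hE0 : 0 < E := Real.exp_pos _
  have hH0 : 0 ≤ Hx := P.hamiltonian_nonneg_of_nonneg hU0 hV0 N x
  have hE1 : E ≤ 1 := by
    rw [hE, Real.exp_le_one_iff, neg_div]
    exact neg_nonpos.2 (div_nonneg hH0 hT.le)
  -- `A + B ≤ 4 H`, `E (A + B) ≤ 4T`, `E (a A + b B) ≤ 8 T²`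
  have hSH : A + B ≤ 4 * Hx := by
    have hk := P.kinetic_le_hamiltonian_of_nonneg hU0 hV0 N x
    have h1 : x.2 ⟨0, hN⟩ ^ 2 / 2 ≤ ∑ i, x.2 i ^ 2 / 2 :=
      Finset.single_le_sum (f := fun i => x.2 i ^ 2 / 2) (fun i _ => by positivity) (Finset.mem_univ _)
    have h2 : x.2 ⟨N - 1, Nat.sub_lt hN one_pos⟩ ^ 2 / 2 ≤ ∑ i, x.2 i ^ 2 / 2 :=
      Finset.single_le_sum (f := fun i => x.2 i ^ 2 / 2) (fun i _ => by positivity) (Finset.mem_univ _)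
    rw [hA, hB]; linarith
  have hES : E * (A + B) ≤ 4 * T := by
    have := mul_exp_neg_div_le hT Hx
    calc E * (A + B) ≤ E * (4 * Hx) := mul_le_mul_of_nonneg_left hSH hE0.le
      _ = 4 * (Hx * Real.exp (-Hx / T)) := by rw [hE]; ring
      _ ≤ 4 * T := by linarith
  have hQ0 : 0 ≤ (T + δ / 2) * A + (T - δ / 2) * B := add_nonneg (mul_nonneg ha0 hA0) (mul_nonneg hb0 hB0)
  have hEQ : E * ((T + δ / 2) * A + (T - δ / 2) * B) ≤ 8 * T ^ 2 := by
    calc E * ((T + δ / 2) * A + (T - δ / 2) * B) ≤ E * (2 * T * (A + B)) := mul_le_mul_of_nonneg_left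
          (by nlinarith [mul_le_mul_of_nonneg_right ha2 hA0, mul_le_mul_of_nonneg_right hb2 hB0]) hE0.le
      _ = 2 * T * (E * (A + B)) := by ring
      _ ≤ 2 * T * (4 * T) := mul_le_mul_of_nonneg_left hES (by linarith)
      _ = 8 * T ^ 2 := by ring
  -- the algebraic identity: the `χ` terms cancel, the error carries `1/R`
  have key : P.γ * ((-(1 / T) * (E * χ₀) + E * χ₁ / R) * (T + δ / 2 + (T - δ / 2) + A + B) +
      (1 / T ^ 2 * (E * χ₀) - 2 / (T * R) * (E * χ₁) + E * χ₂ / R ^ 2) *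
        ((T + δ / 2) * A + (T - δ / 2) * B)) -
      χ₀ * ((-(2 * P.γ) + δ * (P.γ / (2 * T ^ 2)) * (A - B)) * E) =
      P.γ / R * (E * χ₁ * (2 * T + (A + B)) - 2 / T * (E * χ₁) * ((T + δ / 2) * A + (T - δ / 2) * B) +
        E * ((T + δ / 2) * A + (T - δ / 2) * B) * χ₂ / R) := by
    field_simp
    ring
  rw [key, abs_mul, abs_div, abs_of_nonneg hγ, abs_of_pos hR0, div_mul_eq_mul_div]
  apply div_le_div_of_nonneg_right _ hR0.le
  apply mul_le_mul_of_nonneg_left _ hγ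
  have hχ₁ := hM₁ (Hx / R)
  have hχ₂ := hM₂ (Hx / R)
  set Q := (T + δ / 2) * A + (T - δ / 2) * B with hQ
  have t1 : |E * χ₁ * (2 * T + (A + B))| ≤ M₁ * (6 * T) := by
    rw [abs_mul, abs_mul, abs_of_pos hE0, abs_of_nonneg (by positivity : (0:ℝ) ≤ 2 * T + (A + B))]
    calc E * |χ₁| * (2 * T + (A + B)) = |χ₁| * (E * (2 * T) + E * (A + B)) := by ring
      _ ≤ M₁ * (1 * (2 * T) + 4 * T) := by
          apply mul_le_mul hχ₁ _ (by positivity) hM₁0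
          exact add_le_add (mul_le_mul_of_nonneg_right hE1 (by linarith)) hES
      _ = M₁ * (6 * T) := by ring
  have t2 : |2 / T * (E * χ₁) * Q| ≤ M₁ * (16 * T) := by
    rw [abs_mul, abs_mul, abs_mul, abs_of_pos hE0, abs_of_nonneg hQ0, abs_of_pos (by positivity : (0:ℝ) < 2 / T)]
    calc 2 / T * (E * |χ₁|) * Q = 2 / T * (|χ₁| * (E * Q)) := by ring
      _ ≤ 2 / T * (M₁ * (8 * T ^ 2)) := by
          apply mul_le_mul_of_nonneg_left _ (by positivity)
          exact mul_le_mul hχ₁ hEQ (by positivity) hM₁0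
      _ = M₁ * (16 * T) := by field_simp; ring
  have t3 : |E * Q * χ₂ / R| ≤ M₂ * (8 * T ^ 2) := by
    rw [abs_div, abs_of_pos hR0, abs_mul, abs_of_nonneg (mul_nonneg hE0.le hQ0)]
    calc E * Q * |χ₂| / R ≤ E * Q * |χ₂| / 1 := by
          apply div_le_div_of_nonneg_left _ one_pos hR; positivity
      _ = |χ₂| * (E * Q) := by ring
      _ ≤ M₂ * (8 * T ^ 2) := mul_le_mul hχ₂ hEQ (by positivity) hM₂0
  calc |E * χ₁ * (2 * T + (A + B)) - 2 / T * (E * χ₁) * Q + E * Q * χ₂ / R|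
      ≤ |E * χ₁ * (2 * T + (A + B)) - 2 / T * (E * χ₁) * Q| + |E * Q * χ₂ / R| := abs_add_le _ _
    _ ≤ |E * χ₁ * (2 * T + (A + B))| + |2 / T * (E * χ₁) * Q| + |E * Q * χ₂ / R| :=
        add_le_add (abs_sub _ _) le_rfl
    _ ≤ M₁ * (6 * T) + M₁ * (16 * T) + M₂ * (8 * T ^ 2) := add_le_add (add_le_add t1 t2) t3


/-- **Response of the Gibbs density under the reversed kernels at bath temperatures `(T + δ/2, T - δ/2)`.**
For a chain with confining potentials, `N ≥ 1`, `T > 0`, `|δ| ≤ 2T`, every `u ≥ 0` and `y`: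
`e^{2γu} ∫ e^{-H/T} dP̂_u(y,·) - e^{-H(y)/T} = δ (γ/(2T²)) ∫₀ᵘ e^{2γs} ∫ (p_0² - p_{N-1}²) e^{-H/T} dP̂_s(y,·) ds`,
`P̂` the transition kernels of the time-reversed Langevin equation (`langevinRevKernel`). Proof: Dynkin's identity
(`RegularConfinedDrift.sdeKernel_dynkin`) for the truncations `e^{-H/T}χ(H/R) ∈ C²_c`,
`revGenerator_truncGibbs_sub_le_of_temp`, dominated convergence `R → ∞` (all integrands are bounded:
`(p_0² + p_{N-1}²) e^{-H/T} ≤ 4T`), and the integrating factor `e^{2γs}`. [folklore] -/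
theorem gibbsDensity_langevinRevKernel_response (hP : P.IsConfining) (hN : 0 < N) {T δ : ℝ} (hT : 0 < T)
    (hδ : |δ| ≤ 2 * T) {u : ℝ} (hu : 0 ≤ u) (y : PhaseSpace N) :
    Real.exp (2 * P.γ * u) *
          ∫ x, P.gibbsDensity N T x ∂(P.langevinRevKernel N (T + δ / 2) (T - δ / 2) u.toNNReal y) -
        P.gibbsDensity N T y =
      δ * (P.γ / (2 * T ^ 2)) * ∫ s in (0 : ℝ)..u, Real.exp (2 * P.γ * s) *
        ∫ x, (x.2 ⟨0, hN⟩ ^ 2 - x.2 ⟨N - 1, Nat.sub_lt hN one_pos⟩ ^ 2) * P.gibbsDensity N T x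
          ∂(P.langevinRevKernel N (T + δ / 2) (T - δ / 2) s.toNNReal y) := by
  -- notation and basic facts
  set a := T + δ / 2 with ha; set b := T - δ / 2 with hb
  set D := hP.reversedDrift N with hD
  have hv₁ := hP.bathVecL_mem_reversedDrift_noise N a
  have hv₂ := hP.bathVecR_mem_reversedDrift_noise N b
  set κ : ℝ≥0 → Kernel (PhaseSpace N) (PhaseSpace N) := P.langevinRevKernel N a b with hκ
  have hκs : ∀ s, κ s = sdeKernel (fun y => -P.drift N y) (P.bathVecL N a) (P.bathVecR N b) s :=
    fun s => rfl
  haveI hprob : ∀ s z, IsProbabilityMeasure (κ s z) := fun s z =>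
    isProbabilityMeasure_langevinRevKernel hP N a b s z
  set Hm := P.hamiltonian N with hHm
  set ρ : PhaseSpace N → ℝ := P.gibbsDensity N T with hρdef
  have hρ : ρ = fun x => Real.exp (-Hm x / T) := rfl
  have hH2 : ContDiff ℝ 2 Hm := P.contDiff_hamiltonian hP.contDiff_U hP.contDiff_V N
  have hHc : Continuous Hm := hH2.continuous
  have hH0 : ∀ x, 0 ≤ Hm x := fun x => P.hamiltonian_nonneg_of_nonneg hP.U_nonneg hP.V_nonneg N x
  have hρc : Continuous ρ := by rw [hρ]; fun_prop
  have hρ0 : ∀ x, 0 ≤ ρ x := fun x => (Real.exp_pos _).le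
  have hρ1 : ∀ x, ρ x ≤ 1 := fun x => by
    rw [hρ]; dsimp only; rw [Real.exp_le_one_iff, neg_div]; exact neg_nonpos.2 (div_nonneg (hH0 x) hT.le)
  have hρn : ∀ x, ‖ρ x‖ ≤ 1 := fun x => by rw [Real.norm_of_nonneg (hρ0 x)]; exact hρ1 x
  have hγ2 : 0 ≤ 2 * P.γ := by linarith [hP.γ_nonneg]
  -- the weight `W = p_0² - p_{N-1}²`; `W ρ` is bounded by `4T`
  set W : PhaseSpace N → ℝ := fun x => x.2 ⟨0, hN⟩ ^ 2 - x.2 ⟨N - 1, Nat.sub_lt hN one_pos⟩ ^ 2 with hW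
  have hWc : Continuous W := by rw [hW]; fun_prop
  have hWρ : ∀ x, |W x * ρ x| ≤ 4 * T := by
    intro x
    have hk := P.kinetic_le_hamiltonian_of_nonneg hP.U_nonneg hP.V_nonneg N x
    have h1 : x.2 ⟨0, hN⟩ ^ 2 / 2 ≤ ∑ i, x.2 i ^ 2 / 2 :=
      Finset.single_le_sum (f := fun i => x.2 i ^ 2 / 2) (fun i _ => by positivity) (Finset.mem_univ _)
    have h2 : x.2 ⟨N - 1, Nat.sub_lt hN one_pos⟩ ^ 2 / 2 ≤ ∑ i, x.2 i ^ 2 / 2 :=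
      Finset.single_le_sum (f := fun i => x.2 i ^ 2 / 2) (fun i _ => by positivity) (Finset.mem_univ _)
    have hWle : |W x| ≤ 4 * Hm x := by
      rw [hW, abs_le]; constructor <;> nlinarith [sq_nonneg (x.2 ⟨0, hN⟩), sq_nonneg (x.2 ⟨N - 1, Nat.sub_lt hN one_pos⟩)]
    have := mul_exp_neg_div_le hT (Hm x)
    rw [abs_mul, abs_of_nonneg (hρ0 x)]
    calc |W x| * ρ x ≤ 4 * Hm x * ρ x := mul_le_mul_of_nonneg_right hWle (hρ0 x)
      _ = 4 * (Hm x * Real.exp (-Hm x / T)) := by rw [hρ]; ring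
      _ ≤ 4 * T := by linarith
  -- the limit generator image `m = (-2γ + δ c W) ρ`, bounded by `B₀`
  set c := P.γ / (2 * T ^ 2) with hc
  have hc0 : 0 ≤ c := by rw [hc]; exact div_nonneg hP.γ_nonneg (by positivity)
  set m : PhaseSpace N → ℝ := fun x => (-(2 * P.γ) + δ * c * W x) * ρ x with hm
  have hmc : Continuous m := by rw [hm]; exact (continuous_const.add (continuous_const.mul hWc)).mul hρc
  set B₀ : ℝ := 2 * P.γ + |δ| * c * (4 * T) with hB₀
  have hmB : ∀ x, |m x| ≤ B₀ := by
    intro x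
    rw [hm]; dsimp only
    have e : (-(2 * P.γ) + δ * c * W x) * ρ x = -(2 * P.γ) * ρ x + δ * c * (W x * ρ x) := by ring
    rw [e]
    calc |-(2 * P.γ) * ρ x + δ * c * (W x * ρ x)| ≤ |-(2 * P.γ) * ρ x| + |δ * c * (W x * ρ x)| :=
          abs_add_le _ _
      _ ≤ 2 * P.γ + |δ| * c * (4 * T) := by
          apply add_le_add
          · rw [abs_mul, abs_neg, abs_of_nonneg hγ2, abs_of_nonneg (hρ0 x)]
            exact mul_le_of_le_one_right hγ2 (hρ1 x)
          · rw [abs_mul, abs_mul, abs_of_nonneg hc0]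
            exact mul_le_mul_of_nonneg_left (hWρ x) (by positivity)
  have hmn : ∀ x, ‖m x‖ ≤ B₀ := fun x => by rw [Real.norm_eq_abs]; exact hmB x
  -- the truncations
  set ρR : ℕ → PhaseSpace N → ℝ := fun n x => Real.exp (-Hm x / T) * smoothCutoff (Hm x / (n + 1)) with hρR
  have hRpos : ∀ n : ℕ, (0:ℝ) < n + 1 := fun n => by positivity
  have hρR2 : ∀ n, ContDiff ℝ 2 (ρR n) := fun n => by
    have h1 : ContDiff ℝ 2 fun x => Real.exp (-Hm x / T) := (hH2.neg.div_const T).exp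
    have h2 : ContDiff ℝ 2 fun x => smoothCutoff (Hm x / (n + 1)) :=
      (contDiff_smoothCutoff (n := 2)).comp (hH2.div_const _)
    exact h1.mul h2
  have hρRc : ∀ n, Continuous (ρR n) := fun n => (hρR2 n).continuous
  have hρRsupp : ∀ n, HasCompactSupport (ρR n) := fun n => by
    refine HasCompactSupport.intro (hP.isCompact_setOf_hamiltonian_le N (2 * (n + 1))) fun x hx => ?_
    simp only [mem_setOf_eq, not_le] at hx
    have h2 : 2 ≤ Hm x / (n + 1) := by rw [le_div_iff₀ (hRpos n)]; linarith
    show Real.exp (-Hm x / T) * smoothCutoff (Hm x / (n + 1)) = 0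
    rw [smoothCutoff_of_two_le h2, mul_zero]
  have hρR0 : ∀ n x, 0 ≤ ρR n x := fun n x => mul_nonneg (Real.exp_pos _).le (smoothCutoff_nonneg _)
  have hρRle : ∀ n x, ρR n x ≤ ρ x := fun n x => by
    rw [hρ]
    exact mul_le_of_le_one_right (Real.exp_pos _).le (smoothCutoff_le_one _)
  have hρRn : ∀ n x, ‖ρR n x‖ ≤ 1 := fun n x => by
    rw [Real.norm_of_nonneg (hρR0 n x)]; exact (hρRle n x).trans (hρ1 x)
  have hcut : ∀ x, ∀ᶠ n : ℕ in atTop, smoothCutoff (Hm x / (n + 1)) = 1 := fun x => by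
    obtain ⟨n₀, hn₀⟩ := exists_nat_ge (Hm x)
    filter_upwards [eventually_ge_atTop n₀] with n hn
    have h1 : Hm x / (n + 1) ≤ 1 := by
      rw [div_le_one (hRpos n)]
      have : (n₀ : ℝ) ≤ n := by exact_mod_cast hn
      linarith
    exact smoothCutoff_of_le_one h1
  have hρRlim : ∀ x, Tendsto (fun n => ρR n x) atTop (𝓝 (ρ x)) := fun x => by
    refine tendsto_const_nhds.congr' ?_
    filter_upwards [hcut x] with n hn
    show ρ x = Real.exp (-Hm x / T) * smoothCutoff (Hm x / (n + 1))
    rw [hn, mul_one, hρ]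
  -- the generator of the truncations: main part `χ m` plus an `O(1/R)` error
  obtain ⟨C, hC⟩ := revGenerator_truncGibbs_sub_le_of_temp hP.contDiff_U hP.contDiff_V hP.U_nonneg hP.V_nonneg
    hN hP.γ_nonneg hT hδ
  set L := sdeGenerator (fun y => -P.drift N y) (P.bathVecL N a) (P.bathVecR N b) with hL
  set mR : ℕ → PhaseSpace N → ℝ := fun n x => smoothCutoff (Hm x / (n + 1)) * m x with hmR
  set eR : ℕ → PhaseSpace N → ℝ := fun n x => L (ρR n) x - mR n x with heR
  have heRb : ∀ n x, |eR n x| ≤ C / (n + 1) := fun n x =>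
    hC (n + 1) (by linarith [(n.cast_nonneg : (0:ℝ) ≤ n)]) x
  have hC0 : 0 ≤ C := by
    have := (abs_nonneg _).trans (heRb 0 y)
    simpa using this
  have hYc : Continuous fun y => -P.drift N y := D.contDiff_drift.continuous
  have hmRc : ∀ n, Continuous (mR n) := fun n =>
    (contDiff_smoothCutoff (n := 0)).continuous.comp (hHc.div_const _) |>.mul hmc
  have hmRn : ∀ n x, ‖mR n x‖ ≤ B₀ := fun n x => by
    rw [hmR]; dsimp only
    rw [norm_mul, Real.norm_of_nonneg (smoothCutoff_nonneg _)]
    exact (mul_le_of_le_one_left (norm_nonneg _) (smoothCutoff_le_one _)).trans (hmn x)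
  have hmRlim : ∀ x, Tendsto (fun n => mR n x) atTop (𝓝 (m x)) := fun x => by
    refine tendsto_const_nhds.congr' ?_
    filter_upwards [hcut x] with n hn
    show m x = smoothCutoff (Hm x / (n + 1)) * m x
    rw [hn, one_mul]
  have heRc : ∀ n, Continuous (eR n) := fun n =>
    (continuous_sdeGenerator _ _ hYc (hρR2 n)).sub (hmRc n)
  have hLρR : ∀ n x, L (ρR n) x = mR n x + eR n x := fun n x => by
    simp only [heR]; ring
  -- kernel integrals as functions of real time
  set Φ : ℝ → ℝ := fun s => ∫ x, ρ x ∂(κ s.toNNReal y) with hΦ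
  set Ψ : ℝ → ℝ := fun s => ∫ x, W x * ρ x ∂(κ s.toNNReal y) with hΨ
  set ΦR : ℕ → ℝ → ℝ := fun n s => ∫ x, ρR n x ∂(κ s.toNNReal y) with hΦR
  set MR : ℕ → ℝ → ℝ := fun n s => ∫ x, mR n x ∂(κ s.toNNReal y) with hMR
  set ER : ℕ → ℝ → ℝ := fun n s => ∫ x, eR n x ∂(κ s.toNNReal y) with hER
  have hWρn : ∀ x, ‖W x * ρ x‖ ≤ 4 * T := fun x => by rw [Real.norm_eq_abs]; exact hWρ x
  have hΦc : Continuous Φ := continuous_integral_langevinRevKernel hP N a b y hρc hρn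
  have hΨc : Continuous Ψ := continuous_integral_langevinRevKernel hP N a b y (hWc.mul hρc) hWρn
  have hΦRc : ∀ n, Continuous (ΦR n) := fun n => continuous_integral_langevinRevKernel hP N a b y (hρRc n) (hρRn n)
  have hMRc : ∀ n, Continuous (MR n) := fun n => continuous_integral_langevinRevKernel hP N a b y (hmRc n) (hmRn n)
  have hERc : ∀ n, Continuous (ER n) := fun n =>
    continuous_integral_langevinRevKernel hP N a b y (heRc n) (C := C / (n + 1)) fun x => by
      rw [Real.norm_eq_abs]; exact heRb n x
  have hMRle : ∀ n s, |MR n s| ≤ B₀ := fun n s => by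
    have := norm_integral_le_of_norm_le_const (μ := κ s.toNNReal y) (Eventually.of_forall (hmRn n))
    simpa [probReal_univ] using this
  have hERle : ∀ n s, |ER n s| ≤ C / (n + 1) := fun n s => by
    have := norm_integral_le_of_norm_le_const (μ := κ s.toNNReal y)
      (Eventually.of_forall (fun x => show ‖eR n x‖ ≤ C / (n + 1) by rw [Real.norm_eq_abs]; exact heRb n x))
    simpa [probReal_univ] using this
  -- the limit of the main part: `∫ m dP̂_s(y,·) = -2γ Φ s + δ c Ψ s`
  have hmint : ∀ s, ∫ x, m x ∂(κ s.toNNReal y) = -(2 * P.γ) * Φ s + δ * c * Ψ s := by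
    intro s
    have hi1 : Integrable ρ (κ s.toNNReal y) :=
      (integrable_const 1).mono' hρc.aestronglyMeasurable (Eventually.of_forall hρn)
    have hi2 : Integrable (fun x => W x * ρ x) (κ s.toNNReal y) :=
      (integrable_const (4 * T)).mono' (hWc.mul hρc).aestronglyMeasurable (Eventually.of_forall hWρn)
    have e : m = fun x => -(2 * P.γ) * ρ x + δ * c * (W x * ρ x) := by
      funext x; simp only [hm]; ring
    simp only [hΦ, hΨ]
    rw [e, integral_add (hi1.const_mul _) (hi2.const_mul _), integral_const_mul, integral_const_mul]
  -- Dynkin for the truncations: `ΦR n v - ρR n y = ∫₀ᵛ (MR n s + ER n s) ds`, `v ≥ 0`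
  have hdyn : ∀ (n : ℕ) (v : ℝ), 0 ≤ v → ΦR n v - ρR n y = ∫ s in (0:ℝ)..v, (MR n s + ER n s) := by
    intro n v hv
    have h := D.sdeKernel_dynkin hv₁ hv₂ (hρR2 n) (hρRsupp n) v.toNNReal y
    rw [Real.coe_toNNReal _ hv, ← hκs] at h
    simp only [hΦR, hMR, hER]
    rw [h]
    refine intervalIntegral.integral_congr fun s _ => ?_
    rw [← hκs]
    have hint1 : Integrable (mR n) (κ s.toNNReal y) :=
      (integrable_const B₀).mono' (hmRc n).aestronglyMeasurable (Eventually.of_forall (hmRn n))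
    have hint2 : Integrable (eR n) (κ s.toNNReal y) :=
      (integrable_const (C / (n + 1))).mono' (heRc n).aestronglyMeasurable
        (Eventually.of_forall fun x => by rw [Real.norm_eq_abs]; exact heRb n x)
    have e1 : (fun x => L (ρR n) x) = fun x => mR n x + eR n x := funext (hLρR n)
    show ∫ x, L (ρR n) x ∂(κ s.toNNReal y) = (∫ x, mR n x ∂(κ s.toNNReal y)) + ∫ x, eR n x ∂(κ s.toNNReal y)
    rw [e1, integral_add hint1 hint2]
  -- pass to the limit `n → ∞`
  have hlim : ∀ v : ℝ, 0 ≤ v → Φ v - ρ y = ∫ s in (0:ℝ)..v, (-(2 * P.γ) * Φ s + δ * c * Ψ s) := by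
    intro v hv
    have hL1 : Tendsto (fun n => ΦR n v - ρR n y) atTop (𝓝 (Φ v - ρ y)) := by
      refine Tendsto.sub ?_ (hρRlim y)
      simp only [hΦR, hΦ]
      exact tendsto_integral_of_dominated_convergence (fun _ => 1)
        (fun n => (hρRc n).aestronglyMeasurable) (integrable_const 1)
        (fun n => Eventually.of_forall (hρRn n)) (Eventually.of_forall hρRlim)
    have hL2 : Tendsto (fun n => ∫ s in (0:ℝ)..v, (MR n s + ER n s)) atTop
        (𝓝 (∫ s in (0:ℝ)..v, (-(2 * P.γ) * Φ s + δ * c * Ψ s))) := by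
      refine intervalIntegral.tendsto_integral_filter_of_dominated_convergence (fun _ => B₀ + C) ?_ ?_ ?_ ?_
      · exact Eventually.of_forall fun n => ((hMRc n).add (hERc n)).aestronglyMeasurable
      · refine Eventually.of_forall fun n => Eventually.of_forall fun s _ => ?_
        have h1 := hMRle n s
        have h2 := hERle n s
        have h3 : C / (n + 1) ≤ C := div_le_self hC0 (by linarith [(n.cast_nonneg : (0:ℝ) ≤ n)])
        rw [Real.norm_eq_abs]
        calc |MR n s + ER n s| ≤ |MR n s| + |ER n s| := abs_add_le _ _
          _ ≤ B₀ + C := add_le_add h1 (h2.trans h3)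
      · exact intervalIntegrable_const
      · refine Eventually.of_forall fun s _ => ?_
        have hA : Tendsto (fun n => MR n s) atTop (𝓝 (∫ x, m x ∂(κ s.toNNReal y))) := by
          simp only [hMR]
          exact tendsto_integral_of_dominated_convergence (fun _ => B₀)
            (fun n => (hmRc n).aestronglyMeasurable) (integrable_const B₀)
            (fun n => Eventually.of_forall (hmRn n)) (Eventually.of_forall hmRlim)
        have hCn : Tendsto (fun n : ℕ => C / (n + 1)) atTop (𝓝 0) :=
          tendsto_const_nhds.div_atTop (tendsto_natCast_atTop_atTop.atTop_add tendsto_const_nhds)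
        have hB := squeeze_zero_norm (fun n => by rw [Real.norm_eq_abs]; exact hERle n s) hCn
        have := hA.add hB
        rwa [hmint s, add_zero] at this
    have hEq : (fun n => ΦR n v - ρR n y) = fun n => ∫ s in (0:ℝ)..v, (MR n s + ER n s) :=
      funext fun n => hdyn n v hv
    rw [hEq] at hL1
    exact tendsto_nhds_unique hL1 hL2
  -- the integrating factor: `e^{2γs} Φ(s)` has derivative `e^{2γs} δ c Ψ(s)` on `(0, u)`
  set Θ : ℝ → ℝ := fun s => Real.exp (2 * P.γ * s) * Φ s with hΘ
  have hΘc : Continuous Θ := (Real.continuous_exp.comp (continuous_const.mul continuous_id)).mul hΦc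
  have hderiv : ∀ s ∈ Ioo (0:ℝ) u, HasDerivAt Θ (δ * c * (Real.exp (2 * P.γ * s) * Ψ s)) s := by
    intro s hs
    have hs0 : 0 < s := hs.1
    have hF : HasDerivAt (fun r => ρ y + ∫ τ in (0:ℝ)..r, (-(2 * P.γ) * Φ τ + δ * c * Ψ τ))
        (-(2 * P.γ) * Φ s + δ * c * Ψ s) s := by
      have hcts : Continuous fun τ => -(2 * P.γ) * Φ τ + δ * c * Ψ τ :=
        (continuous_const.mul hΦc).add (continuous_const.mul hΨc)
      exact (hcts.integral_hasStrictDerivAt 0 s).hasDerivAt.const_add (ρ y)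
    have hΦd : HasDerivAt Φ (-(2 * P.γ) * Φ s + δ * c * Ψ s) s := by
      refine hF.congr_of_eventuallyEq ?_
      filter_upwards [Ioi_mem_nhds hs0] with r hr
      have := hlim r (le_of_lt hr)
      show Φ r = ρ y + ∫ τ in (0:ℝ)..r, (-(2 * P.γ) * Φ τ + δ * c * Ψ τ)
      linarith
    have h1 : HasDerivAt (fun r : ℝ => 2 * P.γ * r) (2 * P.γ) s := by
      simpa using (hasDerivAt_id s).const_mul (2 * P.γ)
    have hexp : HasDerivAt (fun r => Real.exp (2 * P.γ * r)) (Real.exp (2 * P.γ * s) * (2 * P.γ)) s := h1.exp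
    exact (hexp.mul hΦd).congr_deriv (by ring)
  have hFTC := intervalIntegral.integral_eq_sub_of_hasDerivAt_of_le hu hΘc.continuousOn hderiv
    ((continuous_const.mul ((Real.continuous_exp.comp (continuous_const.mul continuous_id)).mul
      hΨc)).intervalIntegrable _ _)
  have hΘ0 : Θ 0 = ρ y := by
    have h0 : Φ 0 = ρ y := sub_eq_zero.1 (by simpa using hlim 0 le_rfl)
    simp [hΘ, h0]
  rw [intervalIntegral.integral_const_mul, hΘ0] at hFTC
  show Θ u - ρ y = δ * c * ∫ s in (0:ℝ)..u, Real.exp (2 * P.γ * s) * Ψ s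
  rw [hFTC]

/-- **Registered sub-goal `gibbsTTCF_revResponse`** of crux stmt-AtomisticToContinuum-11812 (under `stub_gibbsTTCF`, line
`gibbs-ttcf`): `gibbsDensity_langevinRevKernel_response` for the pinned anharmonic chain with `N + 1` sites
(`ω₂ > 0`, `lam, β, γ ≥ 0`, `T > 0`, `|δ| ≤ 2T`, `u ≥ 0`), weight `p_0² - p_N²`. [folklore] -/
theorem gibbsTTCF_revResponse :
    ∀ ω₂ lam β γ : ℝ, 0 < ω₂ → 0 ≤ lam → 0 ≤ β → 0 ≤ γ → ∀ (N : ℕ) (T δ : ℝ), 0 < T → |δ| ≤ 2 * T → ∀ u : ℝ, 0 ≤ u → ∀ y : PhaseSpace (N + 1), Real.exp (2 * γ * u) * (∫ x, (pinnedChain ω₂ lam β γ).gibbsDensity (N + 1) T x ∂((pinnedChain ω₂ lam β γ).langevinRevKernel (N + 1) (T + δ / 2) (T - δ / 2) u.toNNReal y)) - (pinnedChain ω₂ lam β γ).gibbsDensity (N + 1) T y = δ * (γ / (2 * T ^ 2)) * ∫ s in (0 : ℝ)..u, Real.exp (2 * γ * s) * ∫ x, ((x.2 0) ^ 2 - (x.2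 (Fin.last N)) ^ 2) * (pinnedChain ω₂ lam β γ).gibbsDensity (N + 1) T x ∂((pinnedChain ω₂ lam β γ).langevinRevKernel (N + 1) (T + δ / 2) (T - δ / 2) s.toNNReal y) :=
  fun _ _ _ _ hω hl hβ hγ N _ _ hT hδ _ hu y =>
    gibbsDensity_langevinRevKernel_response (pinnedChain_isConfining hω hl hβ hγ) (Nat.succ_pos N) hT hδ hu y

end Summit.AtomisticToContinuum.FouriersLaw.Theorems.BoundaryKubo.GibbsTtcf

end
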